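import Summits.ResolutionOfSingularities.ResolutionOfSingularities.Theorems.FrobeniusClosingPatchingRelPerfectDepthMultiHostCyl
import Literature.AlgebraicGeometry.Resolution.SmoothUniformizationProofs
import Literature.AlgebraicGeometry.Resolution.AlterationsSectionDivisor
import HarnessLib

/-!
# Crux `PatchingRelPerfect` (stmt-ResolutionOfSingularities-16161), chain W5.2 — F7(β) d = 2 (β-AX), X2a module 2 (M2c):
# the PARAM-LIFT kernel — `IsParamLiftAt` from flatness with regular closed fibre, along local isomorphisms, and at retracted points

[OURS · L1 W5.2 · F7(β) (β-AX) X-side · res-D-pv-034 AS res-L1-s36-pv-3 per res-L1-w52-plan-1 RULING G11-21 (2026-08-27T16:43:39Z: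
«(M2c) PARAM-PROPAGATION KERNEL → res-D-pv-034, `…DepthParamLiftFlat.lean`»; presearch of the ruling: Matsumura 23.7 idiom of
`Literature/…/SmoothUniformizationProofs.lean`).]  Replaces the role of NO printed item; NOT a statement of the manuscript under
review; fact-free, def-free.  AI-written; AI review is weaker than expert review.  Consumers: res-D-pv-054 (M2b `CylState.lift`,
`param` of the lifted retraction: e-chart points by the KERNEL, points off the exceptional divisor by `IsParamLiftAt.of_stalkIso`,
carrier points by `IsParamLiftAt.of_retract`) and res-D-pv-055 (T0 `InitialMultiHost₂`: off `E` the KERNEL, on `E` `of_retract`).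

## Contents
* **`isParamLiftAt_of_flat_of_isRegularLocalRing_fiber`** — THE KERNEL: for `q : V ⟶ Z` and `y ∈ V` with Noetherian stalks, if the
  stalk map `𝒪_{Z, q y} → 𝒪_{V, y}` is FLAT and the closed fibre `𝒪_{V,y} ⧸ 𝔪_{Z,q y}·𝒪_{V,y}` is a regular local ring, then
  `IsParamLiftAt q y` (lift a minimal basis of the fibre's maximal ideal; the count is `emb dim 𝒪_{V,y} = emb dim 𝒪_{Z,q y} +
  emb dim (fibre)`, the tree's `spanFinrank_maximalIdeal_eq_add`, Matsumura 23.7).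
* `isParamLiftAt_iff_of_ringEquiv` / **`IsParamLiftAt.of_stalkIso`** — transport along morphisms `g : V′ ⟶ V`, `h : Z′ ⟶ Z` with
  `q′ ≫ h = g ≫ q` whose stalk maps at `y′`, `q′ y′` are isomorphisms (the points off the exceptional divisors of a lifted
  retraction).
* **`IsParamLiftAt.of_retract`** — at a point `k z` of a closed subscheme `k : Z ⟶ V` RETRACTED by `q` (`k ≫ q = 𝟙`) whose ideal has
  a nonzero principal stalk `(t)` in the regular local ring `𝒪_{V, k z}`: `IsParamLiftAt q (k z)` with the single extra parameter `t`
  (section argument: `𝔪_V = (t) ⊔ 𝔪_Z·𝒪_V`, `dim 𝒪_V = dim 𝒪_Z + 1`).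

## References
* H. Matsumura, *Commutative Ring Theory* (1986), Thm. 23.7 (with Thm. 15.1), Thm. 14.2. [Matsumura1987]
* J. Kollár, *Lectures on Resolution of Singularities* (2007), (3.111) Step 1. [Kollar2007]
-/

-- `Summit.<Summit>.<Sub>.Theorems` with `Sub = Summit` (single-conjunct summit, D-0017)
set_option linter.dupNamespace false

noncomputable section

open CategoryTheory AlgebraicGeometry TopologicalSpace IsLocalRing
open Literature.AlgebraicGeometry.Resolution

namespace Summit.ResolutionOfSingularities.ResolutionOfSingularities.Theorems.DepthMultiHost

universe u

/-! ## §1 The kernel: flat with regular closed fibre -/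

section Kernel

/-- **Ring form of the kernel.** For a local homomorphism `f : A → B` of Noetherian local rings, flat, with regular closed fibre
`B ⧸ 𝔪_A B`: there is a finite `s ⊆ B` with `𝔪_A B ⊔ (s) = 𝔪_B` and `#s + emb dim A = emb dim B`. [cite: Matsumura1987, Thm. 23.7] -/
theorem exists_finset_sup_span_eq_maximalIdeal_of_flat {A B : Type u} [CommRing A] [CommRing B] [IsLocalRing A]
    [IsNoetherianRing A] [IsLocalRing B] [IsNoetherianRing B] (f : A →+* B) [IsLocalHom f] (hflat : f.Flat)
    (hfib : IsRegularLocalRing (B ⧸ (maximalIdeal A).map f)) :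
    ∃ s : Finset B, (maximalIdeal A).map f ⊔ Ideal.span (s : Set B) = maximalIdeal B ∧
      s.card + (maximalIdeal A).spanFinrank = (maximalIdeal B).spanFinrank := by
  classical
  letI := f.toAlgebra
  haveI : IsLocalHom (algebraMap A B) := ‹IsLocalHom f›
  haveI : Module.Flat A B := hflat
  haveI hfib' : IsRegularLocalRing (B ⧸ (maximalIdeal A).map (algebraMap A B)) := hfib
  set I : Ideal B := (maximalIdeal A).map (algebraMap A B) with hI
  set π : B →+* B ⧸ I := Ideal.Quotient.mk I with hπ
  have hπs : Function.Surjective π := Ideal.Quotient.mk_surjective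
  haveI := IsLocalHom.of_surjective π hπs
  have hadd := spanFinrank_maximalIdeal_eq_add (R := A) (S := B)
  -- a minimal basis of the fibre's maximal ideal, lifted to `B`
  obtain ⟨s₀, hs₀card, hs₀span⟩ := Submodule.FG.exists_span_finset_card_eq_spanFinrank
    (maximalIdeal (B ⧸ I)).fg_of_isNoetherianRing
  choose g hg using fun x : B ⧸ I => hπs x
  refine ⟨s₀.image g, ?_, ?_⟩
  · apply le_antisymm
    · refine sup_le (map_maximalIdeal_le _) ?_
      rw [Ideal.span_le]
      intro b hb
      obtain ⟨x, hx, rfl⟩ := Finset.mem_image.mp (Finset.mem_coe.mp hb)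
      have hxm : (x : B ⧸ I) ∈ maximalIdeal (B ⧸ I) := by
        rw [← hs₀span]; exact Submodule.subset_span (Finset.mem_coe.mpr hx)
      have := (map_mem_nonunits_iff π (g x)).mp (by rw [hg]; exact hxm)
      exact this
    · intro b hb
      have hπb : π b ∈ Ideal.span (s₀ : Set (B ⧸ I)) := by
        rw [show Ideal.span (s₀ : Set (B ⧸ I)) = maximalIdeal (B ⧸ I) from hs₀span]
        exact map_nonunit π b hb
      have hs₀g : (s₀ : Set (B ⧸ I)) = π '' ((s₀.image g : Finset B) : Set B) := by
        rw [Finset.coe_image, Set.image_image]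
        ext x; simp [hg]
      rw [hs₀g, ← Ideal.map_span, Ideal.mem_map_iff_of_surjective π hπs] at hπb
      obtain ⟨c, hc, hcb⟩ := hπb
      have hbc : b - c ∈ I := by
        rw [← Ideal.Quotient.eq, ← hπ]; exact hcb.symm
      have : b = (b - c) + c := by ring
      rw [this]
      exact Ideal.add_mem _ (Ideal.mem_sup_left hbc) (Ideal.mem_sup_right hc)
  · have hinj : Set.InjOn g (s₀ : Set (B ⧸ I)) := fun x _ y _ hxy => by
      rw [← hg x, ← hg y, hxy]
    rw [Finset.card_image_of_injOn hinj, hs₀card, hadd, add_comm]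

variable {V Z : Scheme.{u}} (q : V ⟶ Z) (y : V)

/-- [OURS · L1 W5.2 · F7(β) (β-AX) M2c] **THE PARAM-LIFT KERNEL**: a FLAT stalk map with REGULAR closed fibre lifts parameters
(`IsParamLiftAt q y`): lift a minimal basis of the fibre's maximal ideal; `emb dim 𝒪_{V,y} = emb dim 𝒪_{Z,q y} + emb dim (fibre)`
(Matsumura 23.7, tree `spanFinrank_maximalIdeal_eq_add`). [cite: Matsumura1987, Thm. 23.7] -/
theorem isParamLiftAt_of_flat_of_isRegularLocalRing_fiber
    [IsNoetherianRing (Z.presheaf.stalk (q y))] [IsNoetherianRing (V.presheaf.stalk y)]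
    (hflat : (q.stalkMap y).hom.Flat)
    (hfib : IsRegularLocalRing
      (V.presheaf.stalk y ⧸ (maximalIdeal (Z.presheaf.stalk (q y))).map (q.stalkMap y).hom)) :
    IsParamLiftAt q y :=
  exists_finset_sup_span_eq_maximalIdeal_of_flat (q.stalkMap y).hom hflat hfib

end Kernel

/-! ## §2 Transport along stalk isomorphisms -/

section Transport

/-- **Ring form of the transport**: along ring isomorphisms `α : A ≃ A′`, `β : B ≃ B′` intertwining `f : A → B` and
`f′ : A′ → B′`, the PARAM-LIFT data transport. [folklore] -/
theorem exists_finset_sup_span_eq_maximalIdeal_of_ringEquiv {A A' B B' : Type u} [CommRing A] [CommRing A'] [CommRing B]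
    [CommRing B'] [IsLocalRing A] [IsLocalRing A'] [IsLocalRing B] [IsLocalRing B'] (f : A →+* B) (f' : A' →+* B')
    (α : A ≃+* A') (β : B ≃+* B') (hsq : ∀ a, β (f a) = f' (α a))
    (h : ∃ s : Finset B, (maximalIdeal A).map f ⊔ Ideal.span (s : Set B) = maximalIdeal B ∧
      s.card + (maximalIdeal A).spanFinrank = (maximalIdeal B).spanFinrank) :
    ∃ s : Finset B', (maximalIdeal A').map f' ⊔ Ideal.span (s : Set B') = maximalIdeal B' ∧
      s.card + (maximalIdeal A').spanFinrank = (maximalIdeal B').spanFinrank := by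
  classical
  obtain ⟨s, hs1, hs2⟩ := h
  set αh : A →+* A' := α.toRingHom with hαh
  set βh : B →+* B' := β.toRingHom with hβh
  have hcomp : f'.comp αh = βh.comp f := RingHom.ext fun a => (hsq a).symm
  have hA' : maximalIdeal A' = (maximalIdeal A).map αh := (map_ringEquiv_maximalIdeal α).symm
  have hB' : maximalIdeal B' = (maximalIdeal B).map βh := (map_ringEquiv_maximalIdeal β).symm
  refine ⟨s.image β, ?_, ?_⟩
  · rw [hA', hB', Ideal.map_map, hcomp, ← Ideal.map_map, Finset.coe_image,
      show (⇑β '' (s : Set B)) = ⇑βh '' (s : Set B) from rfl, ← Ideal.map_span βh, ← Ideal.map_sup, hs1]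
  · rw [Finset.card_image_of_injective _ β.injective, ← map_ringEquiv_maximalIdeal α, ← map_ringEquiv_maximalIdeal β,
      Ideal.spanFinrank_map_eq_of_ringEquiv, Ideal.spanFinrank_map_eq_of_ringEquiv, hs2]

/-- [OURS · L1 W5.2 · F7(β) (β-AX) M2c] **PARAM-LIFT along local isomorphisms**: for `q′ ≫ h = g ≫ q` with `g`, `h` inducing
isomorphisms of stalks at `y′` and `q′ y′` (e.g. blowing ups at points off their exceptional divisors, open immersions),
`IsParamLiftAt q (g y′)` gives `IsParamLiftAt q′ y′`. [folklore] -/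
theorem IsParamLiftAt.of_stalkIso {V Z V' Z' : Scheme.{u}} (q : V ⟶ Z) (q' : V' ⟶ Z') (g : V' ⟶ V) (h : Z' ⟶ Z)
    (hsq : q' ≫ h = g ≫ q) (y' : V') [IsIso (g.stalkMap y')] [IsIso (h.stalkMap (q' y'))]
    (hq : IsParamLiftAt q (g y')) : IsParamLiftAt q' y' := by
  -- the points `h (q′ y′) = q (g y′)`
  have hpt : q (g y') = h (q' y') := by
    rw [← Scheme.Hom.comp_apply, ← Scheme.Hom.comp_apply, hsq]
  -- stalk isomorphisms
  let c : Z.presheaf.stalk (q (g y')) ≅ Z.presheaf.stalk (h (q' y')) := Z.presheaf.stalkCongr (.of_eq hpt)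
  let α : Z.presheaf.stalk (q (g y')) ≃+* Z'.presheaf.stalk (q' y') := (c ≪≫ asIso (h.stalkMap (q' y'))).commRingCatIsoToRingEquiv
  let β : V.presheaf.stalk (g y') ≃+* V'.presheaf.stalk y' := (asIso (g.stalkMap y')).commRingCatIsoToRingEquiv
  refine exists_finset_sup_span_eq_maximalIdeal_of_ringEquiv (q.stalkMap (g y')).hom (q'.stalkMap y').hom α β ?_ hq
  intro a
  -- both sides are the stalk map of `q′ ≫ h = g ≫ q` at `y′` applied to `a`, up to `stalkCongr`
  have h1 : (g ≫ q).stalkMap y' = q.stalkMap (g y') ≫ g.stalkMap y' := Scheme.Hom.stalkMap_comp g q y'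
  have h2 : (g ≫ q).stalkMap y' = c.hom ≫ (q' ≫ h).stalkMap y' :=
    Scheme.Hom.stalkMap_congr_hom (g ≫ q) (q' ≫ h) hsq.symm y'
  have h3 : (q' ≫ h).stalkMap y' = h.stalkMap (q' y') ≫ q'.stalkMap y' := Scheme.Hom.stalkMap_comp q' h y'
  have h4 : q.stalkMap (g y') ≫ g.stalkMap y' = c.hom ≫ h.stalkMap (q' y') ≫ q'.stalkMap y' := by
    rw [← h1, h2, h3]
  have h5 := congrArg (fun φ => φ.hom a) h4
  change (g.stalkMap y').hom ((q.stalkMap (g y')).hom a) = (q'.stalkMap y').hom ((h.stalkMap (q' y')).hom (c.hom.hom a))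
  simpa using h5

end Transport

/-! ## §3 Retracted points -/

section Retract

/-- **Ring form of the retract case**: `σ : A → B` with a left inverse `π : B → A′` up to isomorphism (`π ∘ σ` bijective), both
local, `B` regular local, `ker π = (t)` with `t ≠ 0` in `𝔪_B`: then `𝔪_A B ⊔ (t) = 𝔪_B` and `1 + emb dim A = emb dim B` (for `A`
regular). [cite: Matsumura1987, Thm. 14.2] -/
theorem exists_finset_sup_span_eq_maximalIdeal_of_section {A A' B : Type u} [CommRing A] [CommRing A'] [CommRing B]
    [IsRegularLocalRing A] [IsLocalRing A'] [IsRegularLocalRing B] (σ : A →+* B) (π : B →+* A') [IsLocalHom σ] [IsLocalHom π]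
    (hbij : Function.Bijective (π.comp σ)) {t : B} (hker : RingHom.ker π = Ideal.span {t}) (ht : t ∈ maximalIdeal B)
    (ht0 : t ≠ 0) :
    ∃ s : Finset B, (maximalIdeal A).map σ ⊔ Ideal.span (s : Set B) = maximalIdeal B ∧
      s.card + (maximalIdeal A).spanFinrank = (maximalIdeal B).spanFinrank := by
  refine ⟨{t}, ?_, ?_⟩
  · -- the section lemma
    rw [Finset.coe_singleton, sup_comm]
    apply le_antisymm
    · refine sup_le ?_ (map_maximalIdeal_le σ)
      rw [Ideal.span_singleton_le_iff_mem]; exact ht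
    · intro b hb
      obtain ⟨a, ha⟩ := hbij.2 (π b)
      have hmem : b - σ a ∈ RingHom.ker π := by
        rw [RingHom.mem_ker, map_sub, ← RingHom.comp_apply, ha, sub_self]
      rw [hker] at hmem
      have ha' : a ∈ maximalIdeal A := by
        have h1 : π b ∈ maximalIdeal A' := map_nonunit π b hb
        rw [← ha] at h1
        exact (map_mem_nonunits_iff (π.comp σ) a).mp h1
      have : b = (b - σ a) + σ a := by ring
      rw [this]
      exact Ideal.add_mem _ (Ideal.mem_sup_left hmem) (Ideal.mem_sup_right (Ideal.mem_map_of_mem σ ha'))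
  · -- the dimension count `dim B = dim A′ + 1 = dim A + 1`
    rw [Finset.card_singleton]
    have e : B ⧸ Ideal.span {t} ≃+* A' :=
      (Ideal.quotEquivOfEq hker.symm).trans (RingHom.quotientKerEquivOfSurjective (Function.Surjective.of_comp (g := σ) hbij.2))
    haveI : IsDomain B := isDomain_of_isRegularLocalRing B
    have hdimB : ringKrullDim B = ringKrullDim A + 1 := by
      rw [ringKrullDim_eq_of_ringEquiv (RingEquiv.ofBijective (π.comp σ) hbij), ← ringKrullDim_eq_of_ringEquiv e]
      exact (ringKrullDim_quotient_span_singleton_succ_eq_ringKrullDim_of_mem_nonZeroDivisors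
        (mem_nonZeroDivisors_of_ne_zero ht0) ht).symm
    have hA := IsRegularLocalRing.spanFinrank_maximalIdeal (R := A)
    have hB := IsRegularLocalRing.spanFinrank_maximalIdeal (R := B)
    rw [hdimB, ← hA] at hB
    have : ((maximalIdeal B).spanFinrank : WithBot ℕ∞) = (((maximalIdeal A).spanFinrank + 1 : ℕ) : WithBot ℕ∞) := by
      rw [hB]; push_cast; rfl
    have h' : (maximalIdeal B).spanFinrank = (maximalIdeal A).spanFinrank + 1 := by exact_mod_cast this
    omega

/-- [OURS · L1 W5.2 · F7(β) (β-AX) M2c] **PARAM-LIFT at a retracted point**: `k : Z ⟶ V` a closed immersion with `k ≫ q = 𝟙 Z`,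
`z ∈ Z` with `𝒪_{V, k z}` and `𝒪_{Z, z}` regular, and the ideal of `k` with a nonzero principal stalk `(t)` at `k z`: then
`IsParamLiftAt q (k z)` — the single extra parameter is the local equation `t` («the E-points are free», res-L1-w52-plan-1
RULING G11-18 (2)(a)). [cite: Kollar2007, (3.111) Step 1] [cite: Matsumura1987, Thm. 14.2] -/
theorem IsParamLiftAt.of_retract {V Z : Scheme.{u}} (q : V ⟶ Z) {k : Z ⟶ V} [IsClosedImmersion k] (hkq : k ≫ q = 𝟙 Z)
    (z : Z) [IsRegularLocalRing (V.presheaf.stalk (k z))] [IsRegularLocalRing (Z.presheaf.stalk z)]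
    {t : V.presheaf.stalk (k z)} (ht : stalkIdeal k.ker (k z) = Ideal.span {t}) (ht0 : t ≠ 0) :
    IsParamLiftAt q (k z) := by
  set σ : Z.presheaf.stalk (q (k z)) →+* V.presheaf.stalk (k z) := (q.stalkMap (k z)).hom with hσ
  set π : V.presheaf.stalk (k z) →+* Z.presheaf.stalk z := (k.stalkMap z).hom with hπ
  have hiso : IsIso ((k ≫ q).stalkMap z) := by
    rw [hkq, Scheme.Hom.stalkMap_id]; exact IsIso.id _
  have hcomp : ((k ≫ q).stalkMap z).hom = π.comp σ := by
    rw [Scheme.Hom.stalkMap_comp]; rfl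
  have hbij : Function.Bijective (π.comp σ) := by
    rw [← hcomp]; exact (asIso ((k ≫ q).stalkMap z)).commRingCatIsoToRingEquiv.bijective
  -- `𝒪_{Z, q (k z)}` is regular: isomorphic to `𝒪_{Z, z}` along `π ∘ σ`
  haveI : IsRegularLocalRing (Z.presheaf.stalk (q (k z))) :=
    IsRegularLocalRing.of_ringEquiv (RingEquiv.ofBijective (π.comp σ) hbij).symm
  have hker : RingHom.ker π = Ideal.span {t} := by
    rw [hπ, ← stalkIdeal_ker_eq_ker_stalkMap k z, ht]
  have htm : t ∈ maximalIdeal (V.presheaf.stalk (k z)) := by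
    have h1 : RingHom.ker π ≤ maximalIdeal _ := le_maximalIdeal (RingHom.ker_ne_top _)
    rw [hker, Ideal.span_singleton_le_iff_mem] at h1
    exact h1
  exact exists_finset_sup_span_eq_maximalIdeal_of_section σ π hbij hker htm ht0

end Retract

end Summit.ResolutionOfSingularities.ResolutionOfSingularities.Theorems.DepthMultiHost

end
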